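import Summits.CriticalPhenomena.PercolationContinuityZ3.Theorems.PercNearOneGluingNoHeavyPcintTFibProcess
import Summits.CriticalPhenomena.PercolationContinuityZ3.Theorems.PercNearOneGluingNoHeavyPcintVdBEFibreBasic
import Literature.Probability.LatticeModels.TriangularLatticeProofs
import HarnessLib

/-!
# PCINT lane, T-fibre route, step (3a): the fibres of the fibre process factorise

Cell `prim-pcint`, seat `prim-pcint-1` (gen 11); memo `run/shared/lean/prim/pcint/T-FIBRE-ROUTE.md` §3.

The structural ("Markov") half of the domination step for the fibre oracle `TFib.outF` run with the cluster exploration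
`ClusterExpl.rule` on a finite `Λ ⊆ 𝕋` (analogue of `…PcintVdBEFibreFactor.lean`, but simpler: the oracle reads only the
fibres of the selected site and of the examined site).

* `traj`, `Fib`, `run_eq_iff_fib` — the replayed trajectory of a state and the fibre tests (`AdaptDom.run_eq_iff_replay`).
* `StepF` — a state `σ` equal to its own `n`-step replay whose selected site `c ≠ o` was examined at step `k₀` by `d`.
* **`StepF.fib_mixG_iff`** — with `W₀ = {c} ∪ C` (`C` = the children examined next):
  `Fib (mixG W₀ u w) ↔ FibRest w ∧ meet (w d) (u c)`, where `FibRest` (the tests other than the test of `c`) does not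
  read `W₀`: `c` is examined once and never selected before, the children are unrevealed.
* `StepF.out_mixG` — at `σ` the children report `meet (u c) (u a)`.
* `StepF.card_C_le` — **a non-root parent has at most `5` children** (`𝕋` is `6`-regular and the examiner `d` of `c`
  is a revealed neighbour).
* `fib_origin_mixG_iff` — at the origin step (`c = o`), with `W = {o} ∪ C`: `Fib (mixG W u w) ↔ FibRest₀ w ∧ u o = allOpen`.
-/

noncomputable section

namespace Summit.CriticalPhenomena.PercolationContinuityZ3.Theorems.Pcint

namespace TFib

open Finset AdaptDom ClusterExpl Literature.Probability.Percolation Literature.Probability.LatticeModels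

variable {m : ℕ} [NeZero m] {Λ : Finset (Site 2)} (enc : ↥Λ → ℕ) (o : ↥Λ)

/-! ### The replayed trajectory and the fibre tests -/

/-- The `k`-th state of the replay of `σ` (`AdaptDom.readOut`): a function of `σ` alone. -/
def traj (σ : ↥Λ → Option Bool) (k : ℕ) : ↥Λ → Option Bool :=
  run (rule (boxGraphT Λ) enc o) (readOut σ) k

/-- **The fibre tests**: `w` passes iff at every replayed state before step `n` the fibre oracle reports, on every
examined site, the value recorded in `σ`. -/
def Fib (m : ℕ) [NeZero m] (n : ℕ) (σ : ↥Λ → Option Bool) (w : ↥Λ → (ZMod m → Bool)) : Prop :=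
  ∀ k < n, ∀ a ∈ rule (boxGraphT Λ) enc o (traj enc o σ k), outF m Λ enc w (traj enc o σ k) a = (σ a).getD false

/-- **Fibres of the run**: `run_n(w) = σ` iff `σ` is its own replay and `w` passes the fibre tests. -/
theorem run_eq_iff_fib (n : ℕ) (σ : ↥Λ → Option Bool) (w : ↥Λ → (ZMod m → Bool)) :
    run (rule (boxGraphT Λ) enc o) (outF m Λ enc w) n = σ ↔ traj enc o σ n = σ ∧ Fib enc o m n σ w :=
  run_eq_iff_replay (rule_unrevealed (boxGraphT Λ) enc o) _ n σ

/-- The root is examined at step `0` of every replay. -/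
theorem root_mem_rule_zero (σ : ↥Λ → Option Bool) : o ∈ rule (boxGraphT Λ) enc o (traj enc o σ 0) := by
  have h0 : ∀ v, traj enc o σ 0 v = none := fun _ => rfl
  have h : rule (boxGraphT Λ) enc o (traj enc o σ 0) = {o} := by rw [rule, if_pos h0]
  rw [h]; exact mem_singleton_self o

/-- The replay's revealed values agree with `σ` (for a state equal to its own `n`-step replay). -/
theorem eq_of_traj {n : ℕ} {σ : ↥Λ → Option Bool} (hcons : traj enc o σ n = σ) {k : ℕ} (hk : k ≤ n) {v : ↥Λ}
    (hv : traj enc o σ k v ≠ none) : σ v = traj enc o σ k v := by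
  have := run_apply_of_ne_none (rule_unrevealed (boxGraphT Λ) enc o) (readOut σ) hv n hk
  change traj enc o σ n v = traj enc o σ k v at this
  rw [hcons] at this; exact this

/-! ### The step context: selected site `c ≠ o` examined at step `k₀` by `d` -/

/-- **Step context** (hypothesis structure of this file): a state `σ` equal to its own `n`-step replay, with selected
site `c ≠ o`, which was examined at the earlier non-initial step `k₀` from the site `d` selected then. -/
structure StepF (m : ℕ) [NeZero m] where
  /-- number of steps -/
  n : ℕ
  /-- the state -/
  σ : ↥Λ → Option Bool
  /-- the selected site of `σ` (parent of the children examined next) -/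
  c : ↥Λ
  /-- the step at which `c` was examined -/
  k₀ : ℕ
  /-- the examiner of `c` -/
  d : ↥Λ
  /-- `σ` is its own replay -/
  hcons : traj enc o σ n = σ
  /-- `c` is selected at `σ` -/
  hsel : sel (boxGraphT Λ) enc σ = some c
  /-- `c` is not the root -/
  hco : c ≠ o
  /-- `k₀` is before `n` -/
  hk₀ : k₀ < n
  /-- the state at `k₀` is not initial -/
  hne₀ : ¬ ∀ v, traj enc o σ k₀ v = none
  /-- `d` is selected at step `k₀` -/
  hseld : sel (boxGraphT Λ) enc (traj enc o σ k₀) = some d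
  /-- `c` is examined at step `k₀` -/
  hcR : c ∈ rule (boxGraphT Λ) enc o (traj enc o σ k₀)

variable {enc o} (X : StepF (Λ := Λ) enc o m)

namespace StepF

/-- The children of `c` (examined next). -/
def C : Finset ↥Λ := rule (boxGraphT Λ) enc o X.σ

/-- The resampled sites: `c` and its children. -/
def W₀ : Finset ↥Λ := insert X.c X.C

/-- The fibre tests other than the test of `c` (at step `k₀`). -/
def FibRest (w : ↥Λ → (ZMod m → Bool)) : Prop :=
  ∀ k < X.n, ∀ a ∈ rule (boxGraphT Λ) enc o (traj enc o X.σ k), ¬ (k = X.k₀ ∧ a = X.c) →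
    outF m Λ enc w (traj enc o X.σ k) a = (X.σ a).getD false

/-- `σ` is not the initial state. -/
theorem σ_ne_init : ¬ ∀ v, X.σ v = none := fun h => by
  obtain ⟨n', hn'⟩ := Nat.exists_eq_add_of_le' (Nat.succ_le_of_lt (lt_of_le_of_lt (Nat.zero_le _) X.hk₀))
  have := not_initial_run_succ (boxGraphT Λ) enc o (readOut X.σ) n'
  rw [← hn'] at this
  exact this (by rw [show run (rule (boxGraphT Λ) enc o) (readOut X.σ) X.n = X.σ from X.hcons]; exact h)

/-- `c` is revealed true. -/
theorem σ_c : X.σ X.c = some true := (sel_revealedTrue (boxGraphT Λ) enc X.hsel).1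

/-- `d` is revealed true at step `k₀` and at `σ`. -/
theorem traj_d : traj enc o X.σ X.k₀ X.d = some true := (sel_revealedTrue (boxGraphT Λ) enc X.hseld).1

/-- `d` is revealed true at `σ`. -/
theorem σ_d : X.σ X.d = some true := by
  rw [eq_of_traj enc o X.hcons X.hk₀.le (by rw [X.traj_d]; simp), X.traj_d]

/-- `d` is adjacent to `c`. -/
theorem adj_d_c : (boxGraphT Λ).Adj X.d X.c := by
  have h := X.hcR
  rw [rule_eq_filter_of_sel (boxGraphT Λ) enc o X.hne₀ X.hseld, mem_filter] at h
  exact h.2.1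

/-- `d ≠ c`. -/
theorem d_ne_c : X.d ≠ X.c := X.adj_d_c.ne

/-- The children are unrevealed neighbours of `c`. -/
theorem mem_C {a : ↥Λ} (ha : a ∈ X.C) : X.σ a = none ∧ (boxGraphT Λ).Adj X.c a := by
  have h := ha
  unfold C at h
  rw [rule_eq_filter_of_sel (boxGraphT Λ) enc o X.σ_ne_init X.hsel, mem_filter] at h
  exact ⟨h.2.2, h.2.1⟩

/-- Membership in `W₀`. -/
theorem mem_W₀ {v : ↥Λ} : v ∈ X.W₀ ↔ v = X.c ∨ v ∈ X.C := by
  unfold W₀; rw [mem_insert]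

/-- `c ∈ W₀`. -/
theorem c_mem_W₀ : X.c ∈ X.W₀ := X.mem_W₀.2 (Or.inl rfl)

/-- A site revealed true other than `c` is not in `W₀`. -/
theorem not_mem_W₀_of_true {v : ↥Λ} (hv : X.σ v = some true) (hvc : v ≠ X.c) : v ∉ X.W₀ := by
  rw [X.mem_W₀]
  rintro (h | h)
  · exact hvc h
  · have := (X.mem_C h).1; rw [hv] at this; exact absurd this (by simp)

/-- `d ∉ W₀`. -/
theorem d_not_mem_W₀ : X.d ∉ X.W₀ := X.not_mem_W₀_of_true X.σ_d X.d_ne_c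

/-- **The root is revealed true** (some non-initial step has a selected site, and selected sites descend from the
root through examiners). -/
theorem σ_o : X.σ o = some true := by
  have key : ∀ (k : ℕ) (v : ↥Λ), traj enc o X.σ k v = some true → X.σ o = some true := by
    intro k
    induction k with
    | zero => intro v hv; simp [traj, run] at hv
    | succ k ih =>
      intro v hv
      by_cases hvk : traj enc o X.σ k v = some true
      · exact ih v hvk
      · have hvR : v ∈ rule (boxGraphT Λ) enc o (traj enc o X.σ k) := by
          by_contra hvR
          have : traj enc o X.σ (k + 1) v = traj enc o X.σ k v := by
            show stepPA (rule (boxGraphT Λ) enc o (traj enc o X.σ k)) (traj enc o X.σ k)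
              (readOut X.σ (traj enc o X.σ k)) v = traj enc o X.σ k v
            unfold stepPA; rw [if_neg hvR]
          rw [this] at hv; exact hvk hv
        by_cases hinit : ∀ u, traj enc o X.σ k u = none
        · have hR : rule (boxGraphT Λ) enc o (traj enc o X.σ k) = {o} := by rw [rule, if_pos hinit]
          rw [hR, mem_singleton] at hvR
          rw [hvR] at hv
          have hk0 : k = 0 := by
            by_contra hk
            obtain ⟨k', rfl⟩ := Nat.exists_eq_succ_of_ne_zero hk
            exact not_initial_run_succ (boxGraphT Λ) enc o (readOut X.σ) k' hinit
          subst hk0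
          have h1 : traj enc o X.σ (0 + 1) o ≠ none := by rw [hv]; simp
          rw [eq_of_traj enc o X.hcons (Nat.succ_le_of_lt (lt_of_le_of_lt (Nat.zero_le _) X.hk₀)) h1, hv]
        · obtain ⟨b, hb, -, -, -⟩ := exists_sel_of_mem_rule (boxGraphT Λ) enc o hinit hvR
          exact ih b (sel_revealedTrue (boxGraphT Λ) enc hb).1
  exact key X.k₀ X.d X.traj_d

/-- `o ∉ W₀`. -/
theorem o_not_mem_W₀ : o ∉ X.W₀ := X.not_mem_W₀_of_true X.σ_o (Ne.symm X.hco)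

/-- **A site examined at a test `(k, a) ≠ (k₀, c)` is not in `W₀`** (`c` is examined once; children are unrevealed). -/
theorem not_mem_W₀_of_examined {k : ℕ} (hk : k < X.n) {a : ↥Λ} (ha : a ∈ rule (boxGraphT Λ) enc o (traj enc o X.σ k))
    (hne : ¬ (k = X.k₀ ∧ a = X.c)) : a ∉ X.W₀ := by
  rw [X.mem_W₀]
  rintro (h | h)
  · subst h
    exact hne ⟨step_unique_of_mem_rule (boxGraphT Λ) enc o (readOut X.σ) ha X.hcR, rfl⟩
  · have h0 := (X.mem_C h).1
    rw [← X.hcons] at h0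
    exact not_mem_rule_of_run_apply_eq_none (boxGraphT Λ) enc o (readOut X.σ) hk h0 ha

/-- **A site selected at a step `1 ≤ k < n` is not in `W₀`** (`c` is selected only at step `n`; selected sites are
revealed true). -/
theorem not_mem_W₀_of_sel {k : ℕ} (hk1 : 1 ≤ k) (hk : k < X.n) {b : ↥Λ}
    (hb : sel (boxGraphT Λ) enc (traj enc o X.σ k) = some b) : b ∉ X.W₀ := by
  have hne : ¬ ∀ v, traj enc o X.σ k v = none := by
    obtain ⟨k', rfl⟩ := Nat.exists_eq_add_of_le' hk1
    exact not_initial_run_succ (boxGraphT Λ) enc o (readOut X.σ) k'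
  have hbT : X.σ b = some true := by
    have h1 := (sel_revealedTrue (boxGraphT Λ) enc hb).1
    rw [eq_of_traj enc o X.hcons hk.le (by rw [h1]; simp), h1]
  refine X.not_mem_W₀_of_true hbT fun h => ?_
  have := sel_ne_of_sel_eq (boxGraphT Λ) enc o (readOut X.σ) hne hb hk
  rw [h] at this
  exact this (show sel (boxGraphT Λ) enc (traj enc o X.σ X.n) = some X.c by rw [X.hcons]; exact X.hsel)

/-- **The tests of `FibRest` do not read `W₀`.** -/
theorem fibRest_mixG_iff (u w : ↥Λ → (ZMod m → Bool)) : X.FibRest (mixG X.W₀ u w) ↔ X.FibRest w := by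
  have key : ∀ k < X.n, ∀ a ∈ rule (boxGraphT Λ) enc o (traj enc o X.σ k), ¬ (k = X.k₀ ∧ a = X.c) →
      outF m Λ enc (mixG X.W₀ u w) (traj enc o X.σ k) a = outF m Λ enc w (traj enc o X.σ k) a := by
    intro k hk a ha hne
    have haW := X.not_mem_W₀_of_examined hk ha hne
    rcases Nat.eq_zero_or_pos k with rfl | hk1
    · have hinit : ∀ v, traj enc o X.σ 0 v = none := fun v => rfl
      rw [outF_init _ hinit, outF_init _ hinit, mixG_of_not_mem haW]
    · have hne' : ¬ ∀ v, traj enc o X.σ k v = none := by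
        obtain ⟨k', rfl⟩ := Nat.exists_eq_add_of_le' hk1
        exact not_initial_run_succ (boxGraphT Λ) enc o (readOut X.σ) k'
      cases hs : sel (boxGraphT Λ) enc (traj enc o X.σ k) with
      | none => rw [outF_none _ hne' hs, outF_none _ hne' hs]
      | some b =>
        have hbW := X.not_mem_W₀_of_sel hk1 hk hs
        rw [outF_sel _ hne' hs, outF_sel _ hne' hs, mixG_of_not_mem haW, mixG_of_not_mem hbW]
  constructor
  · intro h k hk a ha hne; rw [← key k hk a ha hne]; exact h k hk a ha hne
  · intro h k hk a ha hne; rw [key k hk a ha hne]; exact h k hk a ha hne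

/-- **The fibre factorisation**: `Fib (mixG W₀ u w) ↔ FibRest w ∧ meet (w d) (u c)`. -/
theorem fib_mixG_iff (u w : ↥Λ → (ZMod m → Bool)) :
    Fib enc o m X.n X.σ (mixG X.W₀ u w) ↔ X.FibRest w ∧ meet m (w X.d) (u X.c) = true := by
  have htest : outF m Λ enc (mixG X.W₀ u w) (traj enc o X.σ X.k₀) X.c = meet m (w X.d) (u X.c) := by
    rw [outF_sel _ X.hne₀ X.hseld, mixG_of_not_mem X.d_not_mem_W₀, mixG_of_mem X.c_mem_W₀]
  constructor
  · intro h
    refine ⟨(X.fibRest_mixG_iff u w).1 fun k hk a ha _ => h k hk a ha, ?_⟩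
    have := h X.k₀ X.hk₀ X.c X.hcR
    rw [htest, X.σ_c] at this
    exact this
  · rintro ⟨hrest, hmeet⟩ k hk a ha
    by_cases hkc : k = X.k₀ ∧ a = X.c
    · obtain ⟨rfl, rfl⟩ := hkc
      rw [htest, X.σ_c]; exact hmeet
    · exact ((X.fibRest_mixG_iff u w).2 hrest) k hk a ha hkc

/-- **At `σ` the children report `meet (u c) (u a)`** (for a step test function of `C`). -/
theorem out_mixG (u w : ↥Λ → (ZMod m → Bool)) {g : (↥Λ → Bool) → ℝ} (hg : StepTest X.C g) :
    g (outF m Λ enc (mixG X.W₀ u w) X.σ) = g (fun a => if a ∈ X.C then meet m (u X.c) (u a) else false) := by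
  refine hg.2 _ _ fun a ha => ?_
  rw [if_pos ha, outF_sel _ X.σ_ne_init X.hsel, mixG_of_mem X.c_mem_W₀, mixG_of_mem (X.mem_W₀.2 (Or.inr ha))]

/-- **A non-root parent has at most `5` children**: the children are neighbours of `c` in `𝕋` (which has degree `6`)
other than the revealed neighbour `d`. -/
theorem card_C_le : X.C.card ≤ 5 := by
  classical
  have hsub : X.C.image (fun v : ↥Λ => v.1) ⊆ (triGraph.neighborFinset X.c.1).erase X.d.1 := by
    intro x hx
    obtain ⟨a, ha, rfl⟩ := mem_image.1 hx
    obtain ⟨hσa, hadj⟩ := X.mem_C ha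
    refine mem_erase.2 ⟨fun had => ?_, (SimpleGraph.mem_neighborFinset _ _ _).2 ((boxGraphT_adj Λ).1 hadj)⟩
    have : a = X.d := Subtype.ext had
    rw [this, X.σ_d] at hσa
    exact absurd hσa (by simp)
  have hinj : Function.Injective (fun v : ↥Λ => v.1) := Subtype.val_injective
  calc X.C.card = (X.C.image (fun v : ↥Λ => v.1)).card := (card_image_of_injective _ hinj).symm
    _ ≤ ((triGraph.neighborFinset X.c.1).erase X.d.1).card := card_le_card hsub
    _ = 6 - 1 := by
        rw [card_erase_of_mem, card_neighborFinset_triGraph_holds X.c.1]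
        exact (SimpleGraph.mem_neighborFinset _ _ _).2 ((boxGraphT_adj Λ).1 X.adj_d_c.symm)
    _ = 5 := rfl

end StepF

/-! ### The origin step -/

section Origin

variable {n : ℕ} {σ : ↥Λ → Option Bool} (hcons : traj enc o σ n = σ) (hsel : sel (boxGraphT Λ) enc σ = some o)
include hcons hsel

/-- **The fibre tests of the origin step**: with `W = {o} ∪ C`, `Fib (mixG W u w) ↔ FibRest₀ w ∧ u o = allOpen`, where
`FibRest₀` (the tests at steps `≥ 1`) does not read `W`. -/
theorem fib_origin_mixG_iff (u w : ↥Λ → (ZMod m → Bool)) :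
    Fib enc o m n σ (mixG (insert o (rule (boxGraphT Λ) enc o σ)) u w) ↔
      (∀ k < n, ∀ a ∈ rule (boxGraphT Λ) enc o (traj enc o σ k), k ≠ 0 →
        outF m Λ enc w (traj enc o σ k) a = (σ a).getD false) ∧ u o = allOpen m := by
  have hn : 0 < n := by
    refine Nat.pos_of_ne_zero fun hn0 => ?_
    subst hn0
    have h1 := (sel_revealedTrue (boxGraphT Λ) enc hsel).1
    rw [← hcons] at h1; exact absurd h1 (by simp [traj, run])
  have hσo : σ o = some true := (sel_revealedTrue (boxGraphT Λ) enc hsel).1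
  set W := insert o (rule (boxGraphT Λ) enc o σ) with hW
  have hC : ∀ a ∈ rule (boxGraphT Λ) enc o σ, σ a = none := fun a ha => rule_unrevealed (boxGraphT Λ) enc o σ a ha
  have key : ∀ k < n, ∀ a ∈ rule (boxGraphT Λ) enc o (traj enc o σ k), k ≠ 0 →
      outF m Λ enc (mixG W u w) (traj enc o σ k) a = outF m Λ enc w (traj enc o σ k) a := by
    intro k hk a ha hk0
    have hne : ¬ ∀ v, traj enc o σ k v = none := by
      obtain ⟨k', rfl⟩ := Nat.exists_eq_add_of_le' (Nat.pos_of_ne_zero hk0)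
      exact not_initial_run_succ (boxGraphT Λ) enc o (readOut σ) k'
    have haW : a ∉ W := by
      rw [hW, Finset.mem_insert]
      rintro (hao | haC)
      · rw [hao] at ha
        exact hk0 (step_unique_of_mem_rule (boxGraphT Λ) enc o (readOut σ) ha (root_mem_rule_zero enc o σ))
      · have h0 := hC a haC
        rw [← hcons] at h0
        exact not_mem_rule_of_run_apply_eq_none (boxGraphT Λ) enc o (readOut σ) hk h0 ha
    cases hs : sel (boxGraphT Λ) enc (traj enc o σ k) with
    | none => rw [outF_none _ hne hs, outF_none _ hne hs]
    | some b =>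
      have hbW : b ∉ W := by
        rw [hW, Finset.mem_insert]
        rintro (hbo | hbC)
        · have h1 := sel_ne_of_sel_eq (boxGraphT Λ) enc o (readOut σ) hne hs hk
          rw [hbo] at h1
          exact h1 (show sel (boxGraphT Λ) enc (traj enc o σ n) = some o by rw [hcons]; exact hsel)
        · have h0 := hC b hbC
          rw [← hcons] at h0
          exact sel_ne_of_run_apply_eq_none (boxGraphT Λ) enc o (readOut σ) hk.le h0 hs
      rw [outF_sel _ hne hs, outF_sel _ hne hs, mixG_of_not_mem haW, mixG_of_not_mem hbW]
  have h00 : ∀ v, traj enc o σ 0 v = none := fun _ => rfl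
  constructor
  · intro h
    refine ⟨fun k hk a ha hk0 => by rw [← key k hk a ha hk0]; exact h k hk a ha, ?_⟩
    have h0 := h 0 hn o (root_mem_rule_zero enc o σ)
    rw [outF_init _ h00, mixG_of_mem (Finset.mem_insert_self _ _), hσo] at h0
    exact of_decide_eq_true h0
  · rintro ⟨h, ho⟩ k hk a ha
    by_cases hk0 : k = 0
    · subst hk0
      have hao : a = o := by
        have h1 : rule (boxGraphT Λ) enc o (traj enc o σ 0) = {o} := by rw [rule, if_pos h00]
        rw [h1, Finset.mem_singleton] at ha; exact ha
      rw [hao, outF_init _ h00, mixG_of_mem (Finset.mem_insert_self _ _), hσo]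
      exact decide_eq_true ho
    · rw [key k hk a ha hk0]; exact h k hk a ha hk0

omit hcons in
/-- At the origin step the children report `meet allOpen (u a)` (when `u o = allOpen`). -/
theorem out_origin_mixG (u w : ↥Λ → (ZMod m → Bool)) {g : (↥Λ → Bool) → ℝ}
    (hg : StepTest (rule (boxGraphT Λ) enc o σ) g) (huo : u o = allOpen m) :
    g (outF m Λ enc (mixG (insert o (rule (boxGraphT Λ) enc o σ)) u w) σ) =
      g (fun a => if a ∈ rule (boxGraphT Λ) enc o σ then meet m (allOpen m) (u a) else false) := by
  have hne : ¬ ∀ v, σ v = none := fun h => by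
    have := (sel_revealedTrue (boxGraphT Λ) enc hsel).1; rw [h o] at this; exact absurd this (by simp)
  refine hg.2 _ _ fun a ha => ?_
  rw [if_pos ha, outF_sel _ hne hsel, mixG_of_mem (Finset.mem_insert_self _ _),
    mixG_of_mem (Finset.mem_insert_of_mem ha), huo]

end Origin


end TFib

end Summit.CriticalPhenomena.PercolationContinuityZ3.Theorems.Pcint

end
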